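import Summits.ResolutionOfSingularities.ResolutionOfSingularities.Theorems.MarkedTransferCampaignW31UscHolds
import Summits.ResolutionOfSingularities.ResolutionOfSingularities.Theorems.MarkedTransferCampaignW36DiffPowerStalks
import Summits.ResolutionOfSingularities.ResolutionOfSingularities.Theorems.MarkedTransferCampaignW36RsopVeronese
import Literature.AlgebraicGeometry.Hironaka2017.S06BaseHike.R038bHatTheorems
import Literature.AlgebraicGeometry.Resolution.AlterationsStrong
import Mathlib.AlgebraicGeometry.Properties
import HarnessLib

/-!
# [L1 W3.6 · T-AB glue, part 3] The supply lemma T-AB `VeroneseOfLCIOrMonomialCut_ours p` (hence T-B) from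
# Herzog–Hibi–Trung Cor. 2.2 BY NAME, and the W3.6 DOOR «`U30_2_R2_inst`|𝒞» modulo the W3.1 slot statement + that one fact

Cell `res-hironaka`, rung L, slot W3.6 «ord-pow cut» (director-resolution g3 DOOR OF RECORD 2026-08-27T02:23:55Z, WAKE 02:54:48Z:
«T-AB + skeleton registration = res-L1-s36-pv-2»; res-plan-2 03:12:51Z). HOST item stmt-ResolutionOfSingularities-16155 via
`--supports`. HONEST FRAMING (D-0012/D-0089): kernel theorems about OUR typed objects (res-type-010's order-defined
`S06BaseHike.diffPower`, o4's classes `CampaignW36.IsLCICutAt` / `IsMonomialCutAt` and Props of p488503); nothing printed in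
[Hironaka2017] is asserted and the manuscript stays «under review» (it prints no existence argument for `Ě`, p.30 l.4–9).
AI-produced kernel proofs; the statements are closed theorems with standard axioms, CONDITIONAL on exactly one named
published fact, Herzog–Hibi–Trung 2007 Cor. 2.2 (`Literature.RingTheory.MvPolynomial.HerzogHibiTrung2007_Cor2_2`, L-USE fact
F-W36-B1, res-lit-2 p490554) — the finite generation of the symbolic Rees algebra of a squarefree monomial ideal in the form
«some Veronese subalgebra is standard graded». The second fact filed for T-B (F-W36-B2, Matsumura Ex. 22.2 flatness) is NOT
used: its r.s.p. case is the kernel theorem `CampaignW36.flat_aeval_rsop` (part 2, Matsumura Thm. 23.1 in the tree).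

THE GLUE (stalkwise; parts 1–2 = `…W36DiffPowerStalks.lean` p492546, `…W36RsopVeronese.lean`): for a closed `C ⊆ A.Z` that is
A-type or B-type at each of its points, and `b₀` the uniform level of part 2 for the base field `K` and a bound `N ≥ dim 𝒪_{Z,x}`
(all `x`; `Z` is of finite type over `K`): at an A-type point `(𝓘_C^{⟨k b₀⟩})_x ≤ (𝓘_C^{k b₀})_x = ((𝓘_C^{b₀})_x)^k ≤
(𝓘_C^{⟨b₀⟩})_x^k` (res-D-pv-025's pointwise T-A, p490816); at a B-type point `(𝓘_C^{⟨m⟩})_x = ⨅_S (z_S)^m` exactly (part 1)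
and `⨅_S (z_S)^{k b₀} ≤ (⨅_S (z_S)^{b₀})^k` (part 2: HHT in `K[X_1..X_d]`, `d = emb dim 𝒪_{Z,x} ≤ N`, pushed along the flat
`K[X] → 𝒪_{Z,x}`); off `C` both stalks are `⊤`; glue by `le_of_forall_stalkIdeal_le`.

CONTENTS: `exists_nat_ringKrullDim_stalk_le` (uniform bound on `dim 𝒪_{Z,x}` over an ambient datum);
**`CampaignW36.veroneseOfLCIOrMonomialCutOn_of_HHT`** (T-AB per ambient datum), `veroneseOfMonomialCutOn_of_HHT` (T-B per datum,
the special case), **`veroneseOfLCIOrMonomialCut_ours_of_HHT`** / `veroneseOfMonomialCut_ours_of_HHT` (the director's `p`-slices: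
`HerzogHibiTrung2007_Cor2_2 → VeroneseOfLCIOrMonomialCut_ours p`, `→ VeroneseOfMonomialCut_ours p`), and the DOOR compositions
with o4's one-screen glue (p488503 l.238 / l.305): `CampaignW36.coreFocusExistsOn_lciOrMonomial_of_hatUscCutOn_of_HHT`
(⟨UscCut⟩|𝒞 ⇒ `CoreFocusExistsOn LCIOrMonomialClass`), `coreFocusExistsOn_lciOrMonomial_of_invmaxClosed_of_HHT` (from the W3.1
statement `CampaignW31InvmaxClosed`), **`campaignW36CoreFocusExists_lciOrMonomial_of_usc_of_HHT`**
(`CampaignW31UscInvOneExponentI p → HerzogHibiTrung2007_Cor2_2 → CampaignW36CoreFocusExistsOnI LCIOrMonomialClass p` = «`U30_2_R2_inst`|𝒞»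
modulo the W3.1 slot statement and the one fact), the B-type slices, and — since the W3.1 slot statement HOLDS OUTRIGHT
(res-type-076 `campaignW31UscInvOneExponentI_holds`, p491140) — **`campaignW36CoreFocusExists_lciOrMonomial_of_HHT :
HerzogHibiTrung2007_Cor2_2 → CampaignW36CoreFocusExistsOnI LCIOrMonomialClass p`, THE W3.6 DOOR MODULO THE ONE PUBLISHED FACT ONLY**
(and `campaignW36CoreFocusExists_monomial_of_HHT`).
-/

noncomputable section

set_option linter.dupNamespace false -- mandated namespace of this single-conjunct summit

open _root_.AlgebraicGeometry _root_.TopologicalSpace _root_.CategoryTheory _root_.IsLocalRing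

namespace Summit.ResolutionOfSingularities.ResolutionOfSingularities.Theorems

open Literature.AlgebraicGeometry.Resolution
open Literature.AlgebraicGeometry.Hironaka2017
open Literature.AlgebraicGeometry.Hironaka2017.S02Preliminaries
open Literature.AlgebraicGeometry.Hironaka2017.S04CharAlgebra
open Literature.AlgebraicGeometry.Hironaka2017.S06BaseHike
open Literature.AlgebraicGeometry.Hironaka2017.Datum
open Literature.RingTheory.MvPolynomial
open Scheme.IdealSheafData

universe u

namespace CampaignW36

variable {p : ℕ} [Fact p.Prime] {K : Type u} [Field K] [CharP K p]

/-! ## A uniform bound on the dimensions of the local rings of an ambient datum -/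

/-- **`dim 𝒪_{Z,x} ≤ N` uniformly on an ambient datum**: `Z` is quasi-compact and locally of finite type over the field `K`,
hence of finite dimension `≤ N` (tree `exists_topologicalKrullDim_le_of_locallyOfFiniteType`), and `dim 𝒪_{Z,x} = coheight x`
(Stacks 02IZ) is bounded by the dimension of the (sober) space. [cite: StacksProject, Tag 02IZ] [cite: StacksProject, Tag 01TB with Tag 00OS] -/
theorem exists_nat_ringKrullDim_stalk_le (A : AmbientDatum p K) :
    ∃ N : ℕ, ∀ x : A.Z, ringKrullDim (A.Z.presheaf.stalk x) ≤ N := by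
  haveI := A.smooth
  haveI := A.quasiCompact
  haveI : CompactSpace A.Z := QuasiCompact.compactSpace_of_compactSpace A.hom
  obtain ⟨N, hN⟩ := exists_topologicalKrullDim_le_of_locallyOfFiniteType A.hom
  refine ⟨N, fun x => le_trans ?_ hN⟩
  -- adapted from Literature/AlgebraicGeometry/Resolution/HilbertSamuelSemicontinuityExcellentDim.lean (private aux)
  rw [AlgebraicGeometry.ringKrullDim_stalk_eq_coheight, topologicalKrullDim,
    Order.krullDim_eq_of_orderIso (irreducibleSetEquivPoints (α := A.Z))]
  exact Order.coheight_le_krullDim x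

omit [Fact p.Prime] in
/-- The embedding dimension of a regular local ring of dimension `≤ N` is `≤ N`. [folklore] -/
private theorem spanFinrank_le_of_ringKrullDim_le {R : Type u} [CommRing R] [IsRegularLocalRing R] {d N : ℕ}
    (hd : (maximalIdeal R).spanFinrank = d) (hN : ringKrullDim R ≤ N) : d ≤ N := by
  have h := IsRegularLocalRing.spanFinrank_maximalIdeal (R := R)
  rw [hd] at h
  have : ((d : ℕ∞) : WithBot ℕ∞) ≤ ((N : ℕ∞) : WithBot ℕ∞) := h.le.trans hN
  exact_mod_cast this

/-! ## T-AB and T-B from Herzog–Hibi–Trung Cor. 2.2 -/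

/-- **T-AB HOLDS modulo Herzog–Hibi–Trung Cor. 2.2: `CampaignW36.VeroneseOfLCIOrMonomialCutOn A`** for every ambient datum `A` —
every closed `C ⊆ A.Z` that is A-type (`IsLCICutAt`) or B-type (`IsMonomialCutAt`) at each of its points is Veronese-standard at
some level `b₀ > 0`: `𝓘_C^{⟨k b₀⟩} ≤ (𝓘_C^{⟨b₀⟩})^k` for all `k`. The level is the uniform level of part 2 for `K` and a bound on
`dim 𝒪_{Z,x}`; the proof is stalkwise (A-type points: res-D-pv-025's pointwise T-A; B-type points: parts 1–2). NOT a statement of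
the manuscript. [cite: HerzogHibiTrung2007, Cor. 2.2] [cite: Matsumura1987, Thm. 16.2, Thm. 23.1] -/
theorem veroneseOfLCIOrMonomialCutOn_of_HHT (hB1 : HerzogHibiTrung2007_Cor2_2.{u}) (A : AmbientDatum p K) :
    VeroneseOfLCIOrMonomialCutOn A := by
  intro C hC
  haveI := A.smooth
  haveI := A.quasiCompact
  haveI := Scheme.isNoetherian_of_finiteType_over_field A.hom
  obtain ⟨N, hN⟩ := exists_nat_ringKrullDim_stalk_le A
  obtain ⟨b₀, hb₀, hV⟩ := exists_uniform_rsop_veronese hB1 K N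
  refine ⟨b₀, hb₀, fun k => diffPower_mul_le_pow_of_forall_stalk C fun x hx => ?_⟩
  rcases hC x hx with hAx | hBx
  · obtain ⟨rs, hreg, hI⟩ := hAx
    exact stalk_veronese_of_isWeaklyRegularAt C ⟨rs, hreg.toIsWeaklyRegular, hI⟩ b₀ k
  · obtain ⟨d, z, ⟨hreg, hz, hd⟩, 𝒮, h𝒮⟩ := hBx
    haveI := hreg
    letI : Algebra K (A.Z.presheaf.stalk x) := (stalkAlgebraMap A x).toAlgebra
    have hC' : stalkIdeal (vanishingIdeal C) x = 𝒮.inf fun S => Ideal.span (z '' (S : Set (Fin d))) := by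
      rw [h𝒮, Finset.inf_eq_iInf]
    exact stalk_veronese_of_rsop hd z hz 𝒮 hC'
      (hV _ d (spanFinrank_le_of_ringKrullDim_le hd (hN x)) hd z hz 𝒮 k)

/-- **T-B HOLDS modulo Herzog–Hibi–Trung Cor. 2.2: `CampaignW36.VeroneseOfMonomialCutOn A`** (the everywhere-B-type special case of
T-AB). NOT a statement of the manuscript. [cite: HerzogHibiTrung2007, Cor. 2.2] -/
theorem veroneseOfMonomialCutOn_of_HHT (hB1 : HerzogHibiTrung2007_Cor2_2.{u}) (A : AmbientDatum p K) :
    VeroneseOfMonomialCutOn A :=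
  fun C hC => veroneseOfLCIOrMonomialCutOn_of_HHT hB1 A C fun x hx => Or.inr (hC x hx)

/-! ## The door on the class `𝒞`, modulo ⟨UscCut⟩ (slot W3.1) and the one fact -/

variable {IsEdgeData : ∀ ⦃X : Scheme.{u}⦄ ⦃p n : ℕ⦄ (E : IdealExponent X) (ξ : X), EdgeDatumAt p n E ξ → Prop}
variable [PerfectField K] {A : AmbientDatum p K} {n : ℕ}

/-- **⟨UscCut⟩|𝒞 ⇒ `Ě` exists on THE DOOR'S CLASS `𝒞 = LCIOrMonomialClass`**, modulo Herzog–Hibi–Trung Cor. 2.2 only — o4's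
`coreFocusExistsOn_lciOrMonomial_of_veronese` with T-AB discharged. NOT a statement of the manuscript. [cite: HerzogHibiTrung2007, Cor. 2.2] -/
theorem coreFocusExistsOn_lciOrMonomial_of_hatUscCutOn_of_HHT (hB1 : HerzogHibiTrung2007_Cor2_2.{u})
    (hU : HatUscCutOn LCIOrMonomialClass IsEdgeData A n) : CoreFocusExistsOn LCIOrMonomialClass IsEdgeData A n :=
  coreFocusExistsOn_lciOrMonomial_of_veronese hU (veroneseOfLCIOrMonomialCutOn_of_HHT hB1 A)

/-- **⟨UscCut⟩|B-type ⇒ `Ě` exists on the B-type class**, modulo Herzog–Hibi–Trung Cor. 2.2 only. NOT a statement of the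
manuscript. [cite: HerzogHibiTrung2007, Cor. 2.2] -/
theorem coreFocusExistsOn_monomial_of_hatUscCutOn_of_HHT (hB1 : HerzogHibiTrung2007_Cor2_2.{u})
    (hU : HatUscCutOn MonomialClass IsEdgeData A n) : CoreFocusExistsOn MonomialClass IsEdgeData A n :=
  coreFocusExistsOn_monomial_of_veroneseOfMonomialCutOn hU (veroneseOfMonomialCutOn_of_HHT hB1 A)

/-- **FROM THE W3.1 STATEMENT `CampaignW31InvmaxClosed`: `Ě` exists on the door's class**, modulo Herzog–Hibi–Trung Cor. 2.2 only.
NOT a statement of the manuscript. [cite: HerzogHibiTrung2007, Cor. 2.2] -/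
theorem coreFocusExistsOn_lciOrMonomial_of_invmaxClosed_of_HHT (hB1 : HerzogHibiTrung2007_Cor2_2.{u})
    (hW31 : CampaignW31InvmaxClosed.{u} IsEdgeData) : CoreFocusExistsOn LCIOrMonomialClass IsEdgeData A n :=
  coreFocusExistsOn_lciOrMonomial_of_invmaxClosed hW31 (veroneseOfLCIOrMonomialCutOn_of_HHT hB1 A)

end CampaignW36

open CampaignW36

/-! ## The director's `p`-slices -/

/-- **T-AB, the director's `p`-slice, modulo Herzog–Hibi–Trung Cor. 2.2: `HerzogHibiTrung2007_Cor2_2 → VeroneseOfLCIOrMonomialCut_ours p`**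
for every prime `p` (every perfect — indeed every — field `K` of characteristic `p`, every ambient datum). So the W3.6 skeleton's
mixed-class stub is a theorem modulo ONE named published fact. NOT a statement of the manuscript. [cite: HerzogHibiTrung2007, Cor. 2.2]
[cite: Matsumura1987, Thm. 16.2, Thm. 23.1] -/
theorem veroneseOfLCIOrMonomialCut_ours_of_HHT (p : ℕ) [Fact p.Prime] (hB1 : HerzogHibiTrung2007_Cor2_2.{u}) :
    VeroneseOfLCIOrMonomialCut_ours.{u} p :=
  fun _K _ _ _ A => veroneseOfLCIOrMonomialCutOn_of_HHT hB1 A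

/-- **T-B, the director's `p`-slice, modulo Herzog–Hibi–Trung Cor. 2.2: `HerzogHibiTrung2007_Cor2_2 → VeroneseOfMonomialCut_ours p`.**
NOT a statement of the manuscript. [cite: HerzogHibiTrung2007, Cor. 2.2] -/
theorem veroneseOfMonomialCut_ours_of_HHT (p : ℕ) [Fact p.Prime] (hB1 : HerzogHibiTrung2007_Cor2_2.{u}) :
    VeroneseOfMonomialCut_ours.{u} p :=
  fun _K _ _ _ A => veroneseOfMonomialCutOn_of_HHT hB1 A

/-- **THE W3.6 DOOR «`U30_2_R2_inst`|𝒞» modulo the W3.1 slot statement and Herzog–Hibi–Trung Cor. 2.2**: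
`CampaignW31UscInvOneExponentI p → HerzogHibiTrung2007_Cor2_2 → CampaignW36CoreFocusExistsOnI LCIOrMonomialClass p` (o4's one-screen
composition `campaignW36CoreFocusExists_lciOrMonomial_of_usc_of_veronese`, p488503 l.305, with T-AB discharged). NOT a statement of the
manuscript. [cite: HerzogHibiTrung2007, Cor. 2.2] -/
theorem campaignW36CoreFocusExists_lciOrMonomial_of_usc_of_HHT (p : ℕ) [Fact p.Prime]
    (h₁ : CampaignW31UscInvOneExponentI.{u} p) (hB1 : HerzogHibiTrung2007_Cor2_2.{u}) :
    CampaignW36CoreFocusExistsOnI.{u} LCIOrMonomialClass p :=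
  campaignW36CoreFocusExists_lciOrMonomial_of_usc_of_veronese p h₁ (veroneseOfLCIOrMonomialCut_ours_of_HHT p hB1)

/-- **«`U30_2_R2_inst`|B-type» modulo the W3.1 slot statement and Herzog–Hibi–Trung Cor. 2.2.** NOT a statement of the manuscript.
[cite: HerzogHibiTrung2007, Cor. 2.2] -/
theorem campaignW36CoreFocusExists_monomial_of_usc_of_HHT (p : ℕ) [Fact p.Prime]
    (h₁ : CampaignW31UscInvOneExponentI.{u} p) (hB1 : HerzogHibiTrung2007_Cor2_2.{u}) :
    CampaignW36CoreFocusExistsOnI.{u} MonomialClass p :=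
  campaignW36CoreFocusExists_monomial_of_usc_of_veronese p h₁ (veroneseOfMonomialCut_ours_of_HHT p hB1)

/-! ## The door with the W3.1 slot statement discharged (res-type-076 p491140): modulo the ONE published fact only -/

/-- **THE W3.6 DOOR «`U30_2_R2_inst`|𝒞» MODULO HERZOG–HIBI–TRUNG COR. 2.2 ONLY**:
`HerzogHibiTrung2007_Cor2_2 → CampaignW36CoreFocusExistsOnI LCIOrMonomialClass p` — for every prime `p`, every perfect field `K` of
characteristic `p`, every ambient datum, every `n` and every standard ideal exponent `E` with `0 < Ê.b` whose `Inv_max`-stratum closure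
`Σ̄_max` is, at each of its points, a local complete intersection OR a reduced union of coordinate subspaces of a regular system of
parameters, a core focusing `Ě` of `Ê` exists (res-type-076's `campaignW36CoreFocusExists_lciOrMonomial_of_veronese`, p491140's file, with
T-AB discharged here). The remaining premise is the published theorem Herzog–Hibi–Trung, Adv. Math. 210 (2007) Cor. 2.2 (finite generation
of the symbolic Rees algebra of monomial ideals ⇒ a standard-graded Veronese subalgebra), typed as the L-USE fact F-W36-B1. NOT a statement
of the manuscript. [cite: HerzogHibiTrung2007, Cor. 2.2] [cite: Matsumura1987, Thm. 16.2, Thm. 23.1] -/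
theorem campaignW36CoreFocusExists_lciOrMonomial_of_HHT (p : ℕ) [Fact p.Prime] (hB1 : HerzogHibiTrung2007_Cor2_2.{u}) :
    CampaignW36CoreFocusExistsOnI.{u} LCIOrMonomialClass p :=
  campaignW36CoreFocusExists_lciOrMonomial_of_veronese p (veroneseOfLCIOrMonomialCut_ours_of_HHT p hB1)

/-- **«`U30_2_R2_inst`|B-type» MODULO HERZOG–HIBI–TRUNG COR. 2.2 ONLY.** NOT a statement of the manuscript. [cite: HerzogHibiTrung2007, Cor. 2.2] -/
theorem campaignW36CoreFocusExists_monomial_of_HHT (p : ℕ) [Fact p.Prime] (hB1 : HerzogHibiTrung2007_Cor2_2.{u}) :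
    CampaignW36CoreFocusExistsOnI.{u} MonomialClass p :=
  campaignW36CoreFocusExists_monomial_of_veronese p (veroneseOfMonomialCut_ours_of_HHT p hB1)

/-! ## (v2) The level is UNIFORM over the ambient datum: ⟨StableTower `≤ b(A)`⟩ on the class `𝒞` -/

namespace CampaignW36

section Uniform

variable {p : ℕ} [Fact p.Prime] {K : Type u} [Field K] [CharP K p]

/-- **T-AB with a level depending only on the ambient datum** (modulo Herzog–Hibi–Trung Cor. 2.2): for every ambient datum `A` there is
ONE `b₀ > 0` such that EVERY closed `C ⊆ A.Z` that is A-type or B-type at each of its points satisfies `𝓘_C^{⟨k b₀⟩} ≤ (𝓘_C^{⟨b₀⟩})^k`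
for all `k` (`b₀ = b₀(K, N)` for a bound `N ≥ dim 𝒪_{Z,x}`, the uniform ring-level level of part 2; the typed T-AB lets `b₀` depend
on `C`). NOT a statement of the manuscript. [cite: HerzogHibiTrung2007, Cor. 2.2] [cite: Matsumura1987, Thm. 16.2, Thm. 23.1] -/
theorem exists_uniform_veronese_lciOrMonomial_of_HHT (hB1 : HerzogHibiTrung2007_Cor2_2.{u}) (A : AmbientDatum p K) :
    ∃ b₀ : ℕ, 0 < b₀ ∧ ∀ C : Closeds A.Z, (∀ x ∈ (C : Set A.Z), IsLCICutAt C x ∨ IsMonomialCutAt C x) →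
      ∀ k : ℕ, diffPower C (k * b₀) ≤ diffPower C b₀ ^ k := by
  haveI := A.smooth
  haveI := A.quasiCompact
  haveI := Scheme.isNoetherian_of_finiteType_over_field A.hom
  obtain ⟨N, hN⟩ := exists_nat_ringKrullDim_stalk_le A
  obtain ⟨b₀, hb₀, hV⟩ := exists_uniform_rsop_veronese hB1 K N
  refine ⟨b₀, hb₀, fun C hC k => diffPower_mul_le_pow_of_forall_stalk C fun x hx => ?_⟩
  rcases hC x hx with hAx | hBx
  · obtain ⟨rs, hreg, hI⟩ := hAx
    exact stalk_veronese_of_isWeaklyRegularAt C ⟨rs, hreg.toIsWeaklyRegular, hI⟩ b₀ k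
  · obtain ⟨d, z, ⟨hreg, hz, hd⟩, 𝒮, h𝒮⟩ := hBx
    haveI := hreg
    letI : Algebra K (A.Z.presheaf.stalk x) := (stalkAlgebraMap A x).toAlgebra
    have hC' : stalkIdeal (vanishingIdeal C) x = 𝒮.inf fun S => Ideal.span (z '' (S : Set (Fin d))) := by
      rw [h𝒮, Finset.inf_eq_iInf]
    exact stalk_veronese_of_rsop hd z hz 𝒮 hC'
      (hV _ d (spanFinrank_le_of_ringKrullDim_le hd (hN x)) hd z hz 𝒮 k)

variable {IsEdgeData : ∀ ⦃X : Scheme.{u}⦄ ⦃p n : ℕ⦄ (E : IdealExponent X) (ξ : X), EdgeDatumAt p n E ξ → Prop}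
variable [PerfectField K] {A : AmbientDatum p K} {n : ℕ}

/-- **⟨StableTower `b₀ ≤ b`⟩ ON THE DOOR'S CLASS `𝒞` WITH `b = b(A)` DEPENDING ONLY ON THE AMBIENT DATUM** (modulo Herzog–Hibi–Trung
Cor. 2.2): `∃ b > 0, HatStableTowerLEOn LCIOrMonomialClass IsEdgeData b A n` — for every standard `E` on `A.Z` with `0 < Ê.b` whose
`Σ̄_max` is in `𝒞`, the tower of candidates `b' ↦ 𝔖(Ê) ∩ 𝔖((𝓘^{⟨b'⟩}, b'))` is stable at the level `b(A)` (res-type-010's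
`stableAt_of_veronese`, p480948); the GAP-LEDGER R12/12a residual ⟨StableTower⟩ on `𝒞`, with a bound uniform in `E`. NOT a statement of
the manuscript. [cite: HerzogHibiTrung2007, Cor. 2.2] -/
theorem exists_hatStableTowerLEOn_lciOrMonomial_of_HHT (hB1 : HerzogHibiTrung2007_Cor2_2.{u}) :
    ∃ b : ℕ, 0 < b ∧ HatStableTowerLEOn LCIOrMonomialClass IsEdgeData b A n := by
  obtain ⟨b₀, hb₀, hV⟩ := exists_uniform_veronese_lciOrMonomial_of_HHT hB1 A
  refine ⟨b₀, hb₀, fun E ed _ hb _ hC => ?_⟩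
  haveI := A.smooth
  haveI := A.quasiCompact
  haveI := Scheme.isNoetherian_of_finiteType_over_field A.hom
  exact ⟨b₀, hb₀, le_rfl, stableAt_of_veronese A.isRegular_Z (baseHike E) hb _ hb₀ (hV _ hC)⟩

/-- The same on the B-type class. NOT a statement of the manuscript. [cite: HerzogHibiTrung2007, Cor. 2.2] -/
theorem exists_hatStableTowerLEOn_monomial_of_HHT (hB1 : HerzogHibiTrung2007_Cor2_2.{u}) :
    ∃ b : ℕ, 0 < b ∧ HatStableTowerLEOn MonomialClass IsEdgeData b A n := by
  obtain ⟨b, hb, h⟩ := exists_hatStableTowerLEOn_lciOrMonomial_of_HHT (IsEdgeData := IsEdgeData) (A := A) (n := n) hB1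
  exact ⟨b, hb, fun E ed hE hb' hed hC => h E ed hE hb' hed (monomialClass_le _ _ hC)⟩

end Uniform

end CampaignW36

end Summit.ResolutionOfSingularities.ResolutionOfSingularities.Theorems

end
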